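import Mathlib
import HarnessLib
import Literature.Analysis.Calculus.CompactSupportDivergence
import Summits.NavierStokesRegularity.NavierStokesRegularity.Theorems.PoloidalWindowDoorPoloidalWindowRigiditySlopeFunctionSource
import Summits.NavierStokesRegularity.NavierStokesRegularity.Theorems.PoloidalWindowDoorPoloidalWindowRigidityZShockSlopeFunctionPressureLocal

/-!
# Crux K2 `PoloidalWindowRigidity` (stmt-NavierStokesRegularity-19708), line `z_shock` — bridge B3: the CLEBSCH-WEIGHT SOURCE of the
# stratum (SF) is horizontally constant LOCALLY, hence on the z_shock Aut column at every slab point off `{∇ₕv₂ = 0}`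

`--supports stmt-NavierStokesRegularity-19708 --as helper` (leafhand-ns-poloidalwindowdoor-3 g13, cell decomp-ns, 2026-08-31).  Def-free.
**No stub and no summit is closed by this file; Navier–Stokes regularity is NOT proved here (rung 0).**

K2-p2's `…SlopeFunctionSource.horizFDeriv_clebschSource_eq_zero` («on (SF) the source `a = (1 − ∂_sG)f₂ − ∂ₜG + ∂_s²G‖∇v₂‖²` of the
Clebsch weight `u = v₂ − G(t,v₂)` has `∇ₕ a = 0`: the Clebsch weight is a passive scalar driven by a height-only source») uses the
(SF) constraint ONLY through the pressure law AT THE POINT; with the local pressure law of bridge B2 (`…ZShockSlopeFunctionPressureLocal`)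
its proof goes through verbatim for a constraint holding on an open space–time set.  This file records that and composes B1–B3:

* `horizFDeriv_clebschSource_eq_zero_local` — K2-p2's theorem with the constraint `∂₂v_b = ∂_sG(s,v₂)∂_bv₂` assumed on an open `O ∋ (t,x)`
  only (`G ∈ C³(ℝ²)` global); proof = K2-p2's, line by line, fed by `slopeFunction_pressure_local`;
* `exists_antiderivative_of_contDiff` — a jointly `C^∞` slope function `m : ℝ → ℝ → ℝ` has a jointly `C^∞` SLOPE ANTIDERIVATIVE `G`
  (`∂_sG(τ,·) = m τ`; parametric primitive `∫_{w₀}^{w} m(τ,σ)dσ`, Literature `contDiff_parametric_primitive_of_contDiff` + FTC);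
* ★ `clebschSource_horizConst_of_class_autonomy` — **B1 + B2 + B3 composed**: class binders of `stub_zShockThickAut` + the stub's local
  autonomy clause on an open nonempty `W₁` of the slab ⟹ at EVERY `t < 0`, `x` with `∇ₕv₂(t,x) ≠ 0` there are a jointly `C^∞` slope
  antiderivative `G : ℝ → ℝ → ℝ` and an open space–time `O ∋ (t,x)` in the slab with the (SF) constraint `∂_z v_b = ∂_sG(s,v₂)·∂_b v₂` on
  `O` and `∇ₕ a = 0` at EVERY point of `O` — i.e. on the Aut column the Clebsch weight `v₂ − G(t,v₂)` is, locally off `{∇ₕv₂ = 0}`, a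
  passive scalar with a source depending on `(t, x₂)` only, exactly the located residual of (SF) (`…SlopeFunctionPassive`, B4).

HONEST LABEL: bridge lemmas (the z_shock Aut column ≡ K2-p2's (SF) stratum, locally); B4 — the height dependence of the source — is the
open content and is untouched.  presearch: n/a (tree-internal localisation). [folklore]
-/

noncomputable section

-- the summit and its single sub-problem share the name (CONVENTIONS §1), as in every Theorems file
set_option linter.dupNamespace false

namespace Summit.NavierStokesRegularity.NavierStokesRegularity.Theorems.PoloidalWindowDoorPoloidalWindowRigidityZShockSlopeFunctionSourceLocal

open MeasureTheory Set Function Filter Topology TopologicalSpace Metric InnerProductSpace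
open scoped RealInnerProductSpace InnerProductSpace Laplacian ContDiff
open Literature.Analysis Literature.Analysis.FluidPDE
open Summit.NavierStokesRegularity.NavierStokesRegularity.Theorems.LocalSineTubeDoorProfileAlignedWindowRigidityAncient
open Summit.NavierStokesRegularity.NavierStokesRegularity.Theorems.PoloidalWindowDoorPoloidalWindowRigidityWindow
open Summit.NavierStokesRegularity.NavierStokesRegularity.Theorems.PoloidalWindowDoorPoloidalWindowRigidityFlat
open Summit.NavierStokesRegularity.NavierStokesRegularity.Theorems.PoloidalWindowDoorPoloidalWindowRigidityVelocityGradientLaw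
open Summit.NavierStokesRegularity.NavierStokesRegularity.Theorems.PoloidalWindowDoorPoloidalWindowRigiditySeparatedPressure
open Summit.NavierStokesRegularity.NavierStokesRegularity.Theorems.PoloidalWindowDoorPoloidalWindowRigidityMaterialLeibniz
open Summit.NavierStokesRegularity.NavierStokesRegularity.Theorems.PoloidalWindowDoorPoloidalWindowRigidityVerticalSourceGauge
open Summit.NavierStokesRegularity.NavierStokesRegularity.Theorems.PoloidalWindowDoorPoloidalWindowRigidityConstantShearMeans
open Summit.NavierStokesRegularity.NavierStokesRegularity.Theorems.PoloidalWindowDoorPoloidalWindowRigidityConstantShearSlice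
open Summit.NavierStokesRegularity.NavierStokesRegularity.Theorems.PoloidalWindowDoorPoloidalWindowRigiditySlopeFunctionPressure
open Summit.NavierStokesRegularity.NavierStokesRegularity.Theorems.PoloidalWindowDoorPoloidalWindowRigiditySlopeFunctionSource
open Summit.NavierStokesRegularity.NavierStokesRegularity.Theorems.PoloidalWindowDoorPoloidalWindowRigidityZShockSlopeFunctionPressureLocal

variable {C : ℝ} {v : ℝ → EuclideanSpace ℝ (Fin 3) → EuclideanSpace ℝ (Fin 3)}

section Class

variable (hrate : HasTypeITimeDecay C v) (hcont : ContinuousOn (uncurry v) (Iio (0 : ℝ) ×ˢ univ))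
  (hmild : ∀ s t : ℝ, s < t → t < 0 → ∀ x,
    v t x = UnboundedOperators.heatExtension (v s) (t - s) x - oseenDuhamel 1 s v v t x)
  (hdiv : ∀ t < 0, VectorCalculus.IsDivFree (v t))

include hrate hcont hmild hdiv

/-! ### The source of the Clebsch weight is horizontally constant — local form -/

/-- **THE SOURCE OF THE CLEBSCH WEIGHT IS HORIZONTALLY CONSTANT, LOCAL FORM.**  As
`…SlopeFunctionSource.horizFDeriv_clebschSource_eq_zero`, with the (SF) constraint `∂₂v_b = ∂_sG(s,v₂)∂_bv₂` (`b = 0,1`) assumed only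
on an OPEN space–time set `O ∋ (t, x)` (`G ∈ C³(ℝ²)`): at `(t,x)`, for `b = 0,1`,
`∂_b[(1 − ∂_sG(t,v₂)) f₂ − ∂ₜG(t,v₂) + ∂_s²G(t,v₂) Σᵢ(∂ᵢv₂)²] = 0`.  Proof = K2-p2's, fed by the local pressure law. [folklore] -/
theorem horizFDeriv_clebschSource_eq_zero_local
    (hpol : ∀ s < 0, ∀ y, ⟪curl (v s) y, EuclideanSpace.single 2 1⟫_ℝ = 0) {G : ℝ → ℝ → ℝ}
    (hG : ContDiff ℝ 3 (uncurry G)) {t : ℝ} (ht : t < 0) (x : EuclideanSpace ℝ (Fin 3))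
    {O : Set (ℝ × EuclideanSpace ℝ (Fin 3))} (hO : IsOpen O) (hxO : (t, x) ∈ O)
    (hslope : ∀ z ∈ O, ∀ b : Fin 3, b ≠ 2 →
      fderiv ℝ (v z.1) z.2 (EuclideanSpace.single 2 1) b =
        deriv (G z.1) (v z.1 z.2 2) * fderiv ℝ (v z.1) z.2 (EuclideanSpace.single b 1) 2)
    {b : Fin 3} (hb : b ≠ 2) :
    fderiv ℝ (fun y =>
        (1 - deriv (G t) (v t y 2)) * (timeDerivWithin (Iio 0) v t y + convect (v t) (v t) y - Δ (v t) y) 2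
          - deriv (fun τ => G τ (v t y 2)) t
          + deriv (deriv (G t)) (v t y 2) * ∑ i : Fin 3, fderiv ℝ (v t) y (EuclideanSpace.single i 1) 2 ^ 2) x
      (EuclideanSpace.single b 1) = 0 := by
  have hA : IsTypeIAncientMild C v := isTypeIAncientMild_of_class hrate hcont hmild hdiv
  have hs : ContDiff ℝ ∞ (v t) := hA.contDiff_slice ht
  have hsd : Differentiable ℝ (v t) := hs.differentiable (by simp)
  have hG2 : ContDiff ℝ 2 (uncurry G) := hG.of_le (by norm_cast)
  have hGd : ∀ p, DifferentiableAt ℝ (uncurry G) p := fun p => (hG2.differentiable (by norm_num)) p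
  -- ## the slope function `m = ∂_sG` is jointly `C²`
  obtain ⟨m, hm⟩ : ∃ m : ℝ → ℝ → ℝ, ∀ τ σ, m τ σ = deriv (G τ) σ := ⟨_, fun _ _ => rfl⟩
  have hmfun : ∀ τ, m τ = deriv (G τ) := fun τ => funext (hm τ)
  have hm_unc : uncurry m = fun p => fderiv ℝ (uncurry G) p (0, 1) := by
    funext p; rcases p with ⟨τ, σ⟩
    simp only [uncurry_apply_pair, hm]
    exact (hasDerivAt_slices_of_uncurry (hGd (τ, σ))).1.deriv
  have hm2 : ContDiff ℝ 2 (uncurry m) := by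
    rw [hm_unc]; exact (hG.fderiv_right (m := 2) (by norm_cast)).clm_apply contDiff_const
  -- ## the pressure law with this slope function
  have hP := slopeFunction_pressure_local hrate hcont hmild hdiv hpol hm2 ht x hO hxO
    (fun z hz b' hb' => by rw [hm]; exact hslope z hz b' hb') hb
  rw [hm, hmfun t] at hP
  have emt : (fun τ => m τ (v t x 2)) = fun τ => deriv (G τ) (v t x 2) := funext fun τ => hm τ _
  rw [emt] at hP
  -- ## regularity of the pieces at `x`
  have hθ : ContDiff ℝ ∞ (fun y => v t y 2) := contDiff_vert_slice hrate hcont hmild hdiv ht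
  have hθd : DifferentiableAt ℝ (fun y => v t y 2) x := (hθ.differentiable (by simp)) x
  have hGt3 : ContDiff ℝ 3 (G t) := hG.comp (contDiff_const.prodMk contDiff_id)
  have hG'2 : ContDiff ℝ 2 (deriv (G t)) := (contDiff_succ_iff_deriv.1 (hGt3 : ContDiff ℝ ((2 : ℕ∞) + 1 : ℕ∞) (G t))).2.2
  have hG''1 : ContDiff ℝ 1 (deriv (deriv (G t))) :=
    (contDiff_succ_iff_deriv.1 (hG'2 : ContDiff ℝ ((1 : ℕ∞) + 1 : ℕ∞) (deriv (G t)))).2.2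
  have hR := differentiableAt_residual hrate hcont hmild hdiv ht x
  have hF2 : DifferentiableAt ℝ
      (fun y => (timeDerivWithin (Iio 0) v t y + convect (v t) (v t) y - Δ (v t) y) 2) x :=
    ((EuclideanSpace.proj (𝕜 := ℝ) (2 : Fin 3) : EuclideanSpace ℝ (Fin 3) →L[ℝ] ℝ).differentiableAt).comp x hR
  have hEnt : ∀ i : Fin 3, ContDiff ℝ ∞ (fun y => fderiv ℝ (v t) y (EuclideanSpace.single i 1) 2) := fun i =>
    contDiff_fderiv_coord hrate hcont hmild hdiv ht (EuclideanSpace.single i 1) 2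
  have hEntd : ∀ i : Fin 3, DifferentiableAt ℝ (fun y => fderiv ℝ (v t) y (EuclideanSpace.single i 1) 2) x :=
    fun i => ((hEnt i).differentiable (by simp)) x
  have hQd : DifferentiableAt ℝ (fun y => ∑ i : Fin 3, fderiv ℝ (v t) y (EuclideanSpace.single i 1) 2 ^ 2) x := by
    refine DifferentiableAt.fun_sum fun i _ => (hEntd i).pow 2
  -- `∂_sG(t, v₂(·))`, `∂_s²G(t, v₂(·))` and `∂ₜG(t, v₂(·))` along the slice, with their derivatives at `x`
  have hA1 : HasFDerivAt (fun y => deriv (G t) (v t y 2))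
      (deriv (deriv (G t)) (v t x 2) • fderiv ℝ (fun y => v t y 2) x) x :=
    ((hG'2.differentiable (by norm_num)) _).hasDerivAt.comp_hasFDerivAt x hθd.hasFDerivAt
  have hA2 : HasFDerivAt (fun y => deriv (deriv (G t)) (v t y 2))
      (deriv (deriv (deriv (G t))) (v t x 2) • fderiv ℝ (fun y => v t y 2) x) x :=
    ((hG''1.differentiable (by norm_num)) _).hasDerivAt.comp_hasFDerivAt x hθd.hasFDerivAt
  -- the time partial `∂ₜG(t,·)` as a `C²` function of `s`, and Clairaut
  obtain ⟨Gt, hGt⟩ : ∃ Gt : ℝ → ℝ, ∀ σ, Gt σ = deriv (fun τ => G τ σ) t := ⟨_, fun _ => rfl⟩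
  have hGt_eq : Gt = fun σ => fderiv ℝ (uncurry G) (t, σ) (1, 0) :=
    funext fun σ => by rw [hGt]; exact (hasDerivAt_slices_of_uncurry (hGd (t, σ))).2.deriv
  have hGt2 : ContDiff ℝ 2 Gt := by
    rw [hGt_eq]
    exact ((hG.fderiv_right (m := 2) (by norm_cast)).clm_apply contDiff_const).comp
      (contDiff_const.prodMk contDiff_id)
  have hB : HasFDerivAt (fun y => deriv (fun τ => G τ (v t y 2)) t)
      (deriv Gt (v t x 2) • fderiv ℝ (fun y => v t y 2) x) x := by
    have e : (fun y => deriv (fun τ => G τ (v t y 2)) t) = fun y => Gt (v t y 2) := funext fun y => (hGt _).symm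
    rw [e]
    exact ((hGt2.differentiable (by norm_num)) _).hasDerivAt.comp_hasFDerivAt x hθd.hasFDerivAt
  have hClairaut : deriv Gt (v t x 2) = deriv (fun τ => deriv (G τ) (v t x 2)) t := by
    have e : Gt = fun σ => deriv (fun τ => G τ σ) t := funext hGt
    rw [e, deriv_deriv_comm hG2]
  -- ## differentiate the source
  have hT : ∀ w, fderiv ℝ (fun y => v t y 2) x w = fderiv ℝ (v t) x w 2 := fun w =>
    FluidPDE.fderiv_apply_coord (hsd x) w 2
  have hsq : ∀ i : Fin 3, HasFDerivAt (fun y => fderiv ℝ (v t) y (EuclideanSpace.single i 1) 2 ^ 2)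
      ((2 * fderiv ℝ (v t) x (EuclideanSpace.single i 1) 2) •
        fderiv ℝ (fun y => fderiv ℝ (v t) y (EuclideanSpace.single i 1) 2) x) x := by
    intro i
    have h := (hEntd i).hasFDerivAt
    have h2 := h.mul h
    have e1 : (fun y => fderiv ℝ (v t) y (EuclideanSpace.single i 1) 2 ^ 2) =
        fun y => fderiv ℝ (v t) y (EuclideanSpace.single i 1) 2 * fderiv ℝ (v t) y (EuclideanSpace.single i 1) 2 :=
      funext fun y => sq _
    rw [e1, two_mul, add_smul]
    exact h2
  have hQ : HasFDerivAt (fun y => ∑ i : Fin 3, fderiv ℝ (v t) y (EuclideanSpace.single i 1) 2 ^ 2)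
      (∑ i : Fin 3, (2 * fderiv ℝ (v t) x (EuclideanSpace.single i 1) 2) •
        fderiv ℝ (fun y => fderiv ℝ (v t) y (EuclideanSpace.single i 1) 2) x) x :=
    HasFDerivAt.fun_sum fun i _ => hsq i
  have hdQ : fderiv ℝ (fun y => ∑ i : Fin 3, fderiv ℝ (v t) y (EuclideanSpace.single i 1) 2 ^ 2) x
      (EuclideanSpace.single b 1) =
      ∑ i : Fin 3, 2 * fderiv ℝ (v t) x (EuclideanSpace.single i 1) 2 *
        fderiv ℝ (fun y => fderiv ℝ (v t) y (EuclideanSpace.single b 1) 2) x (EuclideanSpace.single i 1) := by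
    rw [hQ.fderiv, FunLike.coe_sum, Finset.sum_apply]
    refine Finset.sum_congr rfl fun i _ => ?_
    simp only [FunLike.coe_smul, Pi.smul_apply, smul_eq_mul]
    -- symmetry of the second derivatives of `v₂`
    have hsym : fderiv ℝ (fun y => fderiv ℝ (v t) y (EuclideanSpace.single i 1) 2) x (EuclideanSpace.single b 1) =
        fderiv ℝ (fun y => fderiv ℝ (v t) y (EuclideanSpace.single b 1) 2) x (EuclideanSpace.single i 1) := by
      have e : ∀ c : EuclideanSpace ℝ (Fin 3), (fun y => fderiv ℝ (v t) y c 2) = fun y => fderiv ℝ (fun z => v t z 2) y c :=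
        fun c => funext fun y => (FluidPDE.fderiv_apply_coord (hsd y) c 2).symm
      rw [e, e]
      exact fderiv_fderiv_symm (hθ.of_le (by norm_cast)) x _ _
    rw [hsym]
  have hdA : fderiv ℝ (fun y => (1 - deriv (G t) (v t y 2)) *
        (timeDerivWithin (Iio 0) v t y + convect (v t) (v t) y - Δ (v t) y) 2) x (EuclideanSpace.single b 1) =
      -(deriv (deriv (G t)) (v t x 2) * fderiv ℝ (v t) x (EuclideanSpace.single b 1) 2) *
          (timeDerivWithin (Iio 0) v t x + convect (v t) (v t) x - Δ (v t) x) 2 +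
        (1 - deriv (G t) (v t x 2)) *
          fderiv ℝ (fun y => timeDerivWithin (Iio 0) v t y + convect (v t) (v t) y - Δ (v t) y) x
            (EuclideanSpace.single b 1) 2 := by
    have h1 : DifferentiableAt ℝ (fun y => 1 - deriv (G t) (v t y 2)) x := hA1.differentiableAt.const_sub 1
    rw [fderiv_fun_mul h1 hF2]
    simp only [_root_.add_apply, FunLike.coe_smul, Pi.smul_apply, smul_eq_mul]
    rw [fderiv_const_sub, hA1.fderiv, ← FluidPDE.fderiv_apply_coord hR]
    simp only [neg_apply, FunLike.coe_smul, Pi.smul_apply, smul_eq_mul, hT]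
    ring
  have hdB : fderiv ℝ (fun y => deriv (fun τ => G τ (v t y 2)) t) x (EuclideanSpace.single b 1) =
      deriv (fun τ => deriv (G τ) (v t x 2)) t * fderiv ℝ (v t) x (EuclideanSpace.single b 1) 2 := by
    rw [hB.fderiv, ← hClairaut]
    simp only [FunLike.coe_smul, Pi.smul_apply, smul_eq_mul, hT]
  have hdC : fderiv ℝ (fun y => deriv (deriv (G t)) (v t y 2) *
        ∑ i : Fin 3, fderiv ℝ (v t) y (EuclideanSpace.single i 1) 2 ^ 2) x (EuclideanSpace.single b 1) =
      deriv (deriv (deriv (G t))) (v t x 2) * fderiv ℝ (v t) x (EuclideanSpace.single b 1) 2 *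
          ∑ i : Fin 3, fderiv ℝ (v t) x (EuclideanSpace.single i 1) 2 ^ 2 +
        deriv (deriv (G t)) (v t x 2) *
          ∑ i : Fin 3, 2 * fderiv ℝ (v t) x (EuclideanSpace.single i 1) 2 *
            fderiv ℝ (fun y => fderiv ℝ (v t) y (EuclideanSpace.single b 1) 2) x (EuclideanSpace.single i 1) := by
    rw [fderiv_fun_mul hA2.differentiableAt hQd]
    simp only [_root_.add_apply, FunLike.coe_smul, Pi.smul_apply, smul_eq_mul]
    rw [hdQ, hA2.fderiv]
    simp only [FunLike.coe_smul, Pi.smul_apply, smul_eq_mul, hT]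
    ring
  -- ## assemble
  have hdAd : DifferentiableAt ℝ (fun y => (1 - deriv (G t) (v t y 2)) *
        (timeDerivWithin (Iio 0) v t y + convect (v t) (v t) y - Δ (v t) y) 2) x :=
    (hA1.differentiableAt.const_sub 1).mul hF2
  have hdAB : DifferentiableAt ℝ (fun y => (1 - deriv (G t) (v t y 2)) *
        (timeDerivWithin (Iio 0) v t y + convect (v t) (v t) y - Δ (v t) y) 2
        - deriv (fun τ => G τ (v t y 2)) t) x := hdAd.sub hB.differentiableAt
  have hdCd : DifferentiableAt ℝ (fun y => deriv (deriv (G t)) (v t y 2) *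
        ∑ i : Fin 3, fderiv ℝ (v t) y (EuclideanSpace.single i 1) 2 ^ 2) x := hA2.differentiableAt.mul hQd
  rw [fderiv_fun_add hdAB hdCd, fderiv_fun_sub hdAd hB.differentiableAt]
  simp only [_root_.add_apply, _root_.sub_apply]
  rw [hdA, hdB, hdC, Finset.mul_sum]
  simp only [Fin.sum_univ_three] at hP ⊢
  linear_combination hP

/-! ### B1 + B2 + B3: the Clebsch-weight source on the z_shock Aut column -/

omit hrate hcont hmild hdiv in
/-- **Slope antiderivative.**  A jointly `C^∞` slope function `m : ℝ → ℝ → ℝ` has a jointly `C^∞` antiderivative in its second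
variable: `G(τ, w) = ∫_{w₀}^{w} m(τ, σ) dσ`, `∂_w G(τ, ·) = m τ` (Literature's parametric primitive + the fundamental theorem of
calculus). [folklore] -/
theorem exists_antiderivative_of_contDiff {m : ℝ → ℝ → ℝ} (hm : ContDiff ℝ ∞ (uncurry m)) (w₀ : ℝ) :
    ∃ G : ℝ → ℝ → ℝ, ContDiff ℝ ∞ (uncurry G) ∧ ∀ τ w, deriv (G τ) w = m τ w := by
  refine ⟨fun τ w => ∫ σ in w₀..w, m τ σ, ?_, fun τ w => ?_⟩
  · have hh : ContDiff ℝ ∞ (fun p : ℝ × ℝ => m p.2 p.1) := by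
      have e : (fun p : ℝ × ℝ => m p.2 p.1) = uncurry m ∘ fun p : ℝ × ℝ => (p.2, p.1) := by
        funext p; rfl
      rw [e]
      exact hm.comp (contDiff_snd.prodMk contDiff_fst)
    have hP := Literature.Analysis.Calculus.contDiff_parametric_primitive_of_contDiff
      (h := fun p : ℝ × ℝ => m p.2 p.1) hh w₀
    have e : uncurry (fun τ w => ∫ σ in w₀..w, m τ σ) =
        (fun q : ℝ × ℝ => ∫ s in w₀..q.1, m q.2 s) ∘ fun p : ℝ × ℝ => (p.2, p.1) := by
      funext p; rfl
    rw [e]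
    exact hP.comp (contDiff_snd.prodMk contDiff_fst)
  · have hc : Continuous (m τ) := hm.continuous.comp (continuous_const.prodMk continuous_id)
    exact hc.deriv_integral (m τ) w₀ w

/-- ★ **B1 + B2 + B3 — on the z_shock Aut column the Clebsch weight is a passive scalar with a `(t, x₂)`-only source, locally.**
Class binders of `stub_zShockThickAut` (Type-I rate, continuity, Oseen identity, divergence-free, poloidal) + the stub's LOCAL autonomy
clause on an open nonempty `W₁` of the backward slab.  Then at EVERY `t < 0` and EVERY `x` with `∇ₕv₂(t,x) ≠ 0` there are a jointly
`C^∞` SLOPE ANTIDERIVATIVE `G : ℝ → ℝ → ℝ` and an open space–time `O ∋ (t,x)` inside the slab such that (i) the (SF) constraint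
`∂_z v_b = ∂_sG(s, v₂)·∂_b v₂` holds on `O` for both `b ≠ 2`, and (ii) at EVERY point of `O` the source
`a = (1 − ∂_sG(s,v₂)) f₂ − ∂ₜG(s,v₂) + ∂_s²G(s,v₂)‖∇v₂‖²` of the Clebsch weight `v₂ − G(s,v₂)` has `∂_b a = 0`, `b = 0, 1`. [folklore] -/
theorem clebschSource_horizConst_of_class_autonomy
    (hpol : ∀ s < 0, ∀ y, ⟪curl (v s) y, EuclideanSpace.single 2 1⟫_ℝ = 0)
    {W₁ : Set (ℝ × EuclideanSpace ℝ (Fin 3))} (hW₁ : IsOpen W₁) (hW₁s : W₁ ⊆ Set.Iio (0 : ℝ) ×ˢ Set.univ)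
    (hW₁ne : W₁.Nonempty) {g : ℝ → ℝ → ℝ}
    (haut : ∀ z ∈ W₁, ∀ b : Fin 3, b ≠ 2 →
      fderiv ℝ (v z.1) z.2 (EuclideanSpace.single 2 1) b =
        g z.1 (v z.1 z.2 2) * fderiv ℝ (v z.1) z.2 (EuclideanSpace.single b 1) 2)
    {t : ℝ} (ht : t < 0) {x : EuclideanSpace ℝ (Fin 3)}
    (hx : fderiv ℝ (v t) x (EuclideanSpace.single 0 1) 2 ≠ 0 ∨ fderiv ℝ (v t) x (EuclideanSpace.single 1 1) 2 ≠ 0) :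
    ∃ G : ℝ → ℝ → ℝ, ContDiff ℝ ∞ (uncurry G) ∧
      ∃ O : Set (ℝ × EuclideanSpace ℝ (Fin 3)), IsOpen O ∧ (t, x) ∈ O ∧ O ⊆ Set.Iio (0 : ℝ) ×ˢ Set.univ ∧
        (∀ z ∈ O, ∀ b : Fin 3, b ≠ 2 →
          fderiv ℝ (v z.1) z.2 (EuclideanSpace.single 2 1) b =
            deriv (G z.1) (v z.1 z.2 2) * fderiv ℝ (v z.1) z.2 (EuclideanSpace.single b 1) 2) ∧
        ∀ z ∈ O, ∀ b : Fin 3, b ≠ 2 →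
          fderiv ℝ (fun y =>
              (1 - deriv (G z.1) (v z.1 y 2)) *
                  (timeDerivWithin (Iio 0) v z.1 y + convect (v z.1) (v z.1) y - Δ (v z.1) y) 2
                - deriv (fun τ => G τ (v z.1 y 2)) z.1
                + deriv (deriv (G z.1)) (v z.1 y 2) *
                    ∑ i : Fin 3, fderiv ℝ (v z.1) y (EuclideanSpace.single i 1) 2 ^ 2) z.2
            (EuclideanSpace.single b 1) = 0 := by
  -- ## B1: an analytic local slope function `m₀` on an open `O₀ ∋ (t, x)`
  obtain ⟨m₀, hm₀, O₀, hO₀, hxO₀, hO₀s, hslope₀⟩ :=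
    PoloidalWindowDoorPoloidalWindowRigidityZShockSlopeFunctionSpaceTime.slopeFunction_spaceTime_of_class_autonomy
      C v hrate hcont hmild hdiv hpol hW₁ hW₁s hW₁ne haut ht hx
  -- ## cut-off: a globally `C^∞` slope function `m` agreeing with `m₀` near `(t, v₂(t,x))`, and its antiderivative `G`
  obtain ⟨M, hMc, hMeq⟩ := exists_contDiff_eventuallyEq_of_contDiffAt hm₀ (⊤ : ℕ∞)
  obtain ⟨A, hAsub, hAo, hpA⟩ := _root_.mem_nhds_iff.1 hMeq
  obtain ⟨G, hGc, hGm⟩ := exists_antiderivative_of_contDiff (m := fun τ w => M (τ, w))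
    (by have e : (uncurry fun τ w => M (τ, w)) = M := by funext q; rfl
        rw [e]; exact hMc) (v t x 2)
  -- ## the open set `O = O₀ ∩ {(s, v₂(s,y)) ∈ A}`
  have hWc : ContinuousOn (fun z : ℝ × EuclideanSpace ℝ (Fin 3) => (z.1, v z.1 z.2 2)) O₀ := by
    have h1 : ContinuousOn (uncurry v) O₀ := hcont.mono hO₀s
    have h2 : ContinuousOn (fun z : ℝ × EuclideanSpace ℝ (Fin 3) => v z.1 z.2 2) O₀ :=
      ((EuclideanSpace.proj (2 : Fin 3) : EuclideanSpace ℝ (Fin 3) →L[ℝ] ℝ).continuous.comp_continuousOn h1)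
    exact continuousOn_fst.prodMk h2
  set O : Set (ℝ × EuclideanSpace ℝ (Fin 3)) := O₀ ∩ (fun z => (z.1, v z.1 z.2 2)) ⁻¹' A with hO
  have hOo : IsOpen O := hWc.isOpen_inter_preimage hO₀ hAo
  have hxO : (t, x) ∈ O := ⟨hxO₀, hpA⟩
  have hOs : O ⊆ Set.Iio (0 : ℝ) ×ˢ Set.univ := fun z hz => hO₀s hz.1
  have hslope : ∀ z ∈ O, ∀ b : Fin 3, b ≠ 2 →
      fderiv ℝ (v z.1) z.2 (EuclideanSpace.single 2 1) b =
        deriv (G z.1) (v z.1 z.2 2) * fderiv ℝ (v z.1) z.2 (EuclideanSpace.single b 1) 2 := by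
    intro z hz b hb
    have hmz : deriv (G z.1) (v z.1 z.2 2) = m₀ z.1 (v z.1 z.2 2) := by
      rw [hGm]
      exact hAsub hz.2
    rw [hmz]
    exact hslope₀ z hz.1 b hb
  refine ⟨G, hGc, O, hOo, hxO, hOs, hslope, fun z hz b hb => ?_⟩
  have hz1 : z.1 < 0 := (Set.mem_prod.1 (hOs hz)).1
  exact horizFDeriv_clebschSource_eq_zero_local hrate hcont hmild hdiv hpol (hGc.of_le (by norm_cast)) hz1 z.2 hOo hz
    hslope hb

end Class

end Summit.NavierStokesRegularity.NavierStokesRegularity.Theorems.PoloidalWindowDoorPoloidalWindowRigidityZShockSlopeFunctionSourceLocal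

end
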